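import Summits.HubbardSuperconductivity.HubbardSuperconductivity.Theorems.AnisotropyChordTransferFibre3TwoHoleBSPointCert
import Summits.HubbardSuperconductivity.HubbardSuperconductivity.Theorems.AnisotropyChordTransferFibre3TwoHoleBSChannel

/-!
# Route `AnisotropyChord` / H0 rotor rung: PROP BS on a point family — model kernel, Sherman–Morrison and the REDUCED two-hole map `P_D`

Twenty-fourth file of the `TwoHoleBS` (PROP BS) chain; second stone of the reduced-slot treatment of the overlapping-cross near
classes (memo HOLE2NEAR-LEAN-g3 §5(a)).  On a point family indexed by `Fin 2 ⊕ Fin n` (`inl` = the two hole centres, `inr` = the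
`n` DISTINCT live boundary points with multiplicities `N`), generalising `…TwoHoleBSChannel` / `…TwoHoleBSRobust` /
`…TwoHoleBSCapacity` (which are tied to the ten slots `Fin 5 ⊕ Fin 5`):
* `kerMatK` (`A_L` on the family), `greenMatK_eq` (`G = Λ̃·11ᵀ − A_L`), `abs_quad_leK`, ★ `pointReal_of_model`
  (model kernel `A_m` within `δ` + margin `δ(Σ|Eu|)²` ⇒ the real point inequality);
* `JK`, `xvecK`, `svecK`, `smInvK` (Sherman–Morrison inverse of `Λ·11ᵀ − A`), `mulVec_xvecK`, `one_vecMul_invK`,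
  ★ `capJ_sub_mul_smInvK`; `padK`, `redP` (`P_D(A,Λ,N)_{ij} = E_{inr i, inr j} − ½N_i[i=j]`), `smInvK_quad_padK`;
* ★★ `pointReal_of_redSkeleton` (symmetric invertible model `A∞`, capacity UPPER bound `Λup ≥ Λ̃_L` with `Λup·s ≠ 1`, and the margin
  `δ·(Σ_k|(E·padK w)_k|)² ≤ wᵀ P_D w` ⇒ the real point inequality), ★★ `dualCert_of_redSkeleton` (plus the boundary-mass identity ⇒ `DualCert`).
What remains for the three classes: the reduced skeleton facts (Perron vector `P_D·1 = 0` from `A∞·v = 1_ζ` with `v = ½N ⊕ α`,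
gap, CND, enclosures) and their kernel certificates, exactly as for the disjoint classes.
Prover seat `hubbard-h0-rotor-p2` g3; helper for stmt-HubbardSuperconductivity-19089 (`--supports`, helper class).
WHAT THIS IS NOT: nothing here proves superconductivity in the Hubbard model; the rotor TARGET as originally worded stays
FALSE (g15 verdict).  Interface only (no pair is certified here).  Mathlib + tree imports only; no sorry, no axioms.
-/

set_option linter.dupNamespace false
set_option autoImplicit false

noncomputable section

open scoped BigOperators
open Complex Finset

namespace Summit.HubbardSuperconductivity.HubbardSuperconductivity.Theorems.AnisotropyChord.Transfer.Fibre3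

namespace TwoHoleBS

variable (L : ℕ) [NeZero L]

/-! ## Model kernels on a point family -/

section Family

variable {κ : Type*} [Fintype κ]

/-- the walk-kernel matrix of a point family, `A_{kl} = a_L(pts k − pts l) = 2·aKer L (2g) (pts k − pts l)`. [folklore] -/
def kerMatK (g : ℝ) (pts : κ → Tor L) : Matrix κ κ ℝ := Matrix.of fun k l => 2 * aKer L (2 * g) (pts k - pts l)

/-- the all-ones matrix. [folklore] -/
def JK : Matrix κ κ ℝ := Matrix.of fun _ _ => 1

omit [Fintype κ] in
/-- `G = Λ̃·11ᵀ − A_L` on the family (`Λ̃ = capT`). [folklore] -/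
theorem greenMatK_eq (g : ℝ) (pts : κ → Tor L) : greenMatK L g pts = capT L g • (JK : Matrix κ κ ℝ) - kerMatK L g pts := by
  ext k l
  simp only [greenMatK, kerMatK, JK, capT, Matrix.of_apply, Matrix.sub_apply, Matrix.smul_apply, smul_eq_mul, mul_one]
  unfold aKer
  ring

omit [NeZero L] in
/-- entrywise-small perturbation against the `ℓ¹` norm: `|xᵀΔx| ≤ δ(Σ|x_k|)²`. [folklore] -/
theorem abs_quad_leK (Δ : Matrix κ κ ℝ) {δ : ℝ} (hδ : ∀ k l, |Δ k l| ≤ δ) (x : κ → ℝ) :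
    |dotProduct x (Δ.mulVec x)| ≤ δ * (∑ k, |x k|) ^ 2 := by
  simp only [dotProduct, Matrix.mulVec, Finset.mul_sum]
  rw [sq, Finset.sum_mul_sum, Finset.mul_sum]
  refine (Finset.abs_sum_le_sum_abs _ _).trans (Finset.sum_le_sum fun p _ => ?_)
  rw [Finset.mul_sum]
  refine (Finset.abs_sum_le_sum_abs _ _).trans (Finset.sum_le_sum fun q _ => ?_)
  rw [abs_mul, abs_mul]
  have h0 : 0 ≤ δ := (abs_nonneg _).trans (hδ p q)
  calc |x p| * (|Δ p q| * |x q|) ≤ |x p| * (δ * |x q|) := by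
        gcongr
        exact hδ p q
    _ = δ * (|x p| * |x q|) := by ring

/-- ★ **MODEL KERNEL + MARGIN ⇒ the real point inequality:** for any real charge map `E` and model kernel `A_m` with `|A_L − A_m| ≤ δ`
entrywise, the inequality `½ΣN_k u_k² + δ(Σ|Eu|)² ≤ 2(Eu)·u − (Eu)ᵀ(Λ̃·11ᵀ − A_m)(Eu)` implies the real point inequality of
`pointCert_of_real`. [folklore] -/
theorem pointReal_of_model (g : ℝ) (pts : κ → Tor L) (N : κ → ℝ) (E Am : Matrix κ κ ℝ) (δ : ℝ)
    (hδ : ∀ k l, |kerMatK L g pts k l - Am k l| ≤ δ) (u : κ → ℝ)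
    (hpos : (1 / 2 : ℝ) * ∑ k, N k * u k ^ 2 + δ * (∑ k, |E.mulVec u k|) ^ 2
        ≤ 2 * dotProduct (E.mulVec u) u - dotProduct (E.mulVec u) ((capT L g • (JK : Matrix κ κ ℝ) - Am).mulVec (E.mulVec u))) :
    (1 / 2 : ℝ) * ∑ k, N k * u k ^ 2
      ≤ 2 * dotProduct (E.mulVec u) u - dotProduct (E.mulVec u) ((greenMatK L g pts).mulVec (E.mulVec u)) := by
  rw [greenMatK_eq]
  have hsplit : (capT L g • (JK : Matrix κ κ ℝ) - kerMatK L g pts)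
      = (capT L g • (JK : Matrix κ κ ℝ) - Am) - (kerMatK L g pts - Am) := by abel
  rw [hsplit, Matrix.sub_mulVec, dotProduct_sub]
  have hΔ : ∀ k l, |(kerMatK L g pts - Am) k l| ≤ δ := fun k l => by rw [Matrix.sub_apply]; exact hδ k l
  have hb := abs_quad_leK (kerMatK L g pts - Am) hΔ (E.mulVec u)
  have a1 := (abs_le.mp hb).1
  linarith

end Family

/-! ## Sherman–Morrison and the reduced two-hole map on `Fin 2 ⊕ Fin n` -/

section Reduced

variable {n : ℕ}

/-- harmonic-measure vector `x = A⁻¹1`. [folklore] -/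
def xvecK (A : Matrix (Fin 2 ⊕ Fin n) (Fin 2 ⊕ Fin n) ℝ) : Fin 2 ⊕ Fin n → ℝ := A⁻¹.mulVec fun _ => 1

/-- `s = 1ᵀA⁻¹1`. [folklore] -/
def svecK (A : Matrix (Fin 2 ⊕ Fin n) (Fin 2 ⊕ Fin n) ℝ) : ℝ := ∑ k, xvecK A k

/-- Sherman–Morrison inverse of `Λ·11ᵀ − A`: `−A⁻¹ + [Λ/(Λs − 1)] x xᵀ`. [folklore] -/
def smInvK (A : Matrix (Fin 2 ⊕ Fin n) (Fin 2 ⊕ Fin n) ℝ) (Λ : ℝ) : Matrix (Fin 2 ⊕ Fin n) (Fin 2 ⊕ Fin n) ℝ :=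
  -A⁻¹ + (Λ / (Λ * svecK A - 1)) • Matrix.vecMulVec (xvecK A) (xvecK A)

/-- `A x = 1`. [folklore] -/
theorem mulVec_xvecK (A : Matrix (Fin 2 ⊕ Fin n) (Fin 2 ⊕ Fin n) ℝ) (hA : IsUnit A.det) :
    A.mulVec (xvecK A) = fun _ => 1 := by
  unfold xvecK
  rw [Matrix.mulVec_mulVec, Matrix.mul_nonsing_inv _ hA, Matrix.one_mulVec]

/-- for symmetric `A`: `1ᵀA⁻¹ = xᵀ`. [folklore] -/
theorem one_vecMul_invK (A : Matrix (Fin 2 ⊕ Fin n) (Fin 2 ⊕ Fin n) ℝ) (hs : A.IsSymm) :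
    Matrix.vecMul (fun _ => (1 : ℝ)) A⁻¹ = xvecK A := by
  have h : (A⁻¹).IsSymm := by
    unfold Matrix.IsSymm at *
    rw [Matrix.transpose_nonsing_inv, hs]
  rw [← Matrix.mulVec_transpose, h.eq]
  rfl

/-- ★ SHERMAN–MORRISON: `(Λ·11ᵀ − A)·(−A⁻¹ + [Λ/(Λs−1)] x xᵀ) = 1`. [folklore] -/
theorem capJ_sub_mul_smInvK (A : Matrix (Fin 2 ⊕ Fin n) (Fin 2 ⊕ Fin n) ℝ) (hs : A.IsSymm) (hA : IsUnit A.det)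
    (Λ : ℝ) (h : Λ * svecK A - 1 ≠ 0) :
    (Λ • (JK : Matrix (Fin 2 ⊕ Fin n) (Fin 2 ⊕ Fin n) ℝ) - A) * smInvK A Λ = 1 := by
  have hx := mulVec_xvecK A hA
  have hcol := one_vecMul_invK A hs
  have hsdef : dotProduct (fun _ => (1 : ℝ)) (xvecK A) = svecK A := by
    simp [dotProduct, svecK]
  have hJ : (JK : Matrix (Fin 2 ⊕ Fin n) (Fin 2 ⊕ Fin n) ℝ) = Matrix.vecMulVec (fun _ => (1 : ℝ)) (fun _ => (1 : ℝ)) := by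
    ext i j; simp [JK, Matrix.vecMulVec_apply]
  unfold smInvK
  rw [hJ, Matrix.sub_mul, Matrix.mul_add, Matrix.mul_add, Matrix.mul_neg, Matrix.mul_neg,
    Matrix.mul_nonsing_inv _ hA, Matrix.mul_smul, Matrix.mul_smul, Matrix.smul_mul, Matrix.smul_mul,
    Matrix.vecMulVec_mul, hcol, Matrix.vecMulVec_mul_vecMulVec, hsdef, Matrix.mul_vecMulVec, hx]
  ext i j
  simp only [Matrix.sub_apply, Matrix.add_apply, Matrix.neg_apply, Matrix.smul_apply, Matrix.vecMulVec_apply,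
    Pi.smul_apply, smul_eq_mul, Matrix.one_apply]
  field_simp
  ring

/-- live boundary data padded by zeros at the two centres. [folklore] -/
def padK (w : Fin n → ℝ) : Fin 2 ⊕ Fin n → ℝ := Sum.elim 0 w

/-- ★ the REDUCED two-hole map `P_D(A,Λ,N)_{ij} = (smInvK A Λ)_{inr i, inr j} − ½N_i[i = j]`. [folklore] -/
def redP (A : Matrix (Fin 2 ⊕ Fin n) (Fin 2 ⊕ Fin n) ℝ) (Λ : ℝ) (N : Fin n → ℝ) : Matrix (Fin n) (Fin n) ℝ :=
  Matrix.of fun i j => smInvK A Λ (Sum.inr i) (Sum.inr j) - (if i = j then N i / 2 else 0)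

/-- sums over the family of a function vanishing at the centres. [folklore] -/
theorem sum_eq_sum_inr {F : Fin 2 ⊕ Fin n → ℝ} (h : ∀ c : Fin 2, F (Sum.inl c) = 0) :
    ∑ k, F k = ∑ j : Fin n, F (Sum.inr j) := by
  rw [Fintype.sum_sum_type]
  simp [h]

/-- `(M v)_i = Σ_j M_{ij} v_j` (definitional). [folklore] -/
theorem mulVec_apply_sum {ι : Type*} [Fintype ι] (M : Matrix ι ι ℝ) (v : ι → ℝ) (i : ι) :
    M.mulVec v i = ∑ j, M i j * v j := rfl

/-- `(E·padK w)·padK w = wᵀ P_D w + ½ Σ N_i w_i²`. [folklore] -/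
theorem smInvK_quad_padK (A : Matrix (Fin 2 ⊕ Fin n) (Fin 2 ⊕ Fin n) ℝ) (Λ : ℝ) (N : Fin n → ℝ) (w : Fin n → ℝ) :
    dotProduct ((smInvK A Λ).mulVec (padK w)) (padK w)
      = dotProduct w ((redP A Λ N).mulVec w) + (1 / 2 : ℝ) * ∑ j, N j * w j ^ 2 := by
  have h2 : ∀ j : Fin n, (smInvK A Λ).mulVec (padK w) (Sum.inr j)
      = ∑ i : Fin n, smInvK A Λ (Sum.inr j) (Sum.inr i) * w i := by
    intro j
    rw [mulVec_apply_sum, sum_eq_sum_inr (F := fun k => smInvK A Λ (Sum.inr j) k * padK w k) (fun c => by simp [padK])]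
    rfl
  have h3 : ∀ j : Fin n, (redP A Λ N).mulVec w j
      = (∑ i : Fin n, smInvK A Λ (Sum.inr j) (Sum.inr i) * w i) - N j / 2 * w j := by
    intro j
    rw [mulVec_apply_sum]
    simp only [redP, Matrix.of_apply, sub_mul, Finset.sum_sub_distrib, ite_mul, zero_mul, Finset.sum_ite_eq,
      Finset.mem_univ, if_true]
  unfold dotProduct
  rw [sum_eq_sum_inr (F := fun k => (smInvK A Λ).mulVec (padK w) k * padK w k) (fun c => by simp [padK])]
  simp only [h2, h3]
  simp only [padK, Sum.elim_inr]
  rw [Finset.mul_sum, ← Finset.sum_add_distrib]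
  exact Finset.sum_congr rfl fun j _ => by ring

/-- ★★ **REDUCED SKELETON + CAPACITY UPPER BOUND ⇒ the real point inequality:** for the family `pts : Fin 2 ⊕ Fin n → Tor L` with
the pair at the `inl` indices, a symmetric invertible model kernel `A∞` within `δ` of `A_L`, a capacity parameter `Λup ≥ Λ̃_L`
with `Λup·s ≠ 1`, and the margin `δ(Σ_k|(E·padK w)_k|)² ≤ wᵀP_D w` for all live data `w` (`E = smInvK A∞ Λup`), the real point
inequality holds for every real `u` vanishing at the indices of the pair. [folklore] -/
theorem pointReal_of_redSkeleton (g : ℝ) (z₁ z₂ : Tor L) (pts : Fin 2 ⊕ Fin n → Tor L) (N : Fin n → ℝ)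
    (hz : pts (Sum.inl 0) = z₁ ∧ pts (Sum.inl 1) = z₂)
    (Ainf : Matrix (Fin 2 ⊕ Fin n) (Fin 2 ⊕ Fin n) ℝ) (hs : Ainf.IsSymm) (hA : IsUnit Ainf.det) (Λup : ℝ)
    (hΛ : Λup * svecK Ainf - 1 ≠ 0) (hcap : capT L g ≤ Λup) (δ : ℝ)
    (hδ : ∀ k l, |kerMatK L g pts k l - Ainf k l| ≤ δ)
    (hpos : ∀ w : Fin n → ℝ,
      δ * (∑ k, |(smInvK Ainf Λup).mulVec (padK w) k|) ^ 2 ≤ dotProduct w ((redP Ainf Λup N).mulVec w))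
    (u : Fin 2 ⊕ Fin n → ℝ) (hu : ∀ k, (pts k = z₁ ∨ pts k = z₂) → u k = 0) :
    (1 / 2 : ℝ) * ∑ k, Sum.elim (fun _ => (0 : ℝ)) N k * u k ^ 2
      ≤ 2 * dotProduct ((smInvK Ainf Λup).mulVec u) u
        - dotProduct ((smInvK Ainf Λup).mulVec u) ((greenMatK L g pts).mulVec ((smInvK Ainf Λup).mulVec u)) := by
  -- `u` vanishes at the centres, so `u = padK w`
  have hu0 : u (Sum.inl 0) = 0 := hu _ (Or.inl hz.1)
  have hu1 : u (Sum.inl 1) = 0 := hu _ (Or.inr hz.2)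
  set w : Fin n → ℝ := fun j => u (Sum.inr j) with hw
  have hupad : u = padK w := by
    funext k
    rcases k with c | j
    · fin_cases c
      · simpa [padK] using hu0
      · simpa [padK] using hu1
    · rfl
  rw [hupad]
  set E := smInvK Ainf Λup with hE
  refine pointReal_of_model L g pts (Sum.elim (fun _ => (0 : ℝ)) N) E Ainf δ hδ (padK w) ?_
  -- Sherman–Morrison at `Λup` and the capacity surplus
  have hprod := capJ_sub_mul_smInvK Ainf hs hA Λup hΛ
  have hGE : (Λup • (JK : Matrix (Fin 2 ⊕ Fin n) (Fin 2 ⊕ Fin n) ℝ) - Ainf).mulVec (E.mulVec (padK w)) = padK w := by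
    rw [Matrix.mulVec_mulVec, hprod, Matrix.one_mulVec]
  have hsplit : ∀ y : Fin 2 ⊕ Fin n → ℝ, (capT L g • (JK : Matrix (Fin 2 ⊕ Fin n) (Fin 2 ⊕ Fin n) ℝ) - Ainf).mulVec y
      = (Λup • (JK : Matrix (Fin 2 ⊕ Fin n) (Fin 2 ⊕ Fin n) ℝ) - Ainf).mulVec y - (Λup - capT L g) • (JK.mulVec y) := by
    intro y
    rw [← Matrix.smul_mulVec, ← Matrix.sub_mulVec]
    congr 1
    ext p q
    simp only [Matrix.sub_apply, Matrix.smul_apply, smul_eq_mul]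
    ring
  have hJquad : ∀ y : Fin 2 ⊕ Fin n → ℝ, dotProduct y ((JK : Matrix (Fin 2 ⊕ Fin n) (Fin 2 ⊕ Fin n) ℝ).mulVec y) = (∑ k, y k) ^ 2 := by
    intro y
    unfold dotProduct
    simp only [mulVec_apply_sum, JK, Matrix.of_apply, one_mul]
    rw [sq, Finset.sum_mul_sum]
    simp only [Finset.mul_sum]
  rw [hsplit, hGE, dotProduct_sub, dotProduct_smul, smul_eq_mul, hJquad, smInvK_quad_padK]
  have hN : ∑ k, Sum.elim (fun _ => (0 : ℝ)) N k * padK w k ^ 2 = ∑ j, N j * w j ^ 2 := by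
    rw [Fintype.sum_sum_type]; simp [padK]
  rw [hN]
  have hb : 0 ≤ (Λup - capT L g) * (∑ k, E.mulVec (padK w) k) ^ 2 := mul_nonneg (by linarith) (sq_nonneg _)
  have := hpos w
  linarith

/-- ★★ **DUAL CERTIFICATE FROM THE REDUCED SKELETON:** the boundary-mass identity for the family plus the hypotheses of
`pointReal_of_redSkeleton` give `DualCert L g z₁ z₂`. [folklore] -/
theorem dualCert_of_redSkeleton (g : ℝ) (z₁ z₂ : Tor L) (pts : Fin 2 ⊕ Fin n → Tor L) (N : Fin n → ℝ)
    (hz : pts (Sum.inl 0) = z₁ ∧ pts (Sum.inl 1) = z₂)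
    (hnbr : ∀ φ : Tor L → ℂ, φ z₁ = 0 → φ z₂ = 0 →
      nbr L φ z₁ + nbr L φ z₂ = ∑ k, Sum.elim (fun _ => (0 : ℝ)) N k * ‖φ (pts k)‖ ^ 2)
    (Ainf : Matrix (Fin 2 ⊕ Fin n) (Fin 2 ⊕ Fin n) ℝ) (hs : Ainf.IsSymm) (hA : IsUnit Ainf.det) (Λup : ℝ)
    (hΛ : Λup * svecK Ainf - 1 ≠ 0) (hcap : capT L g ≤ Λup) (δ : ℝ)
    (hδ : ∀ k l, |kerMatK L g pts k l - Ainf k l| ≤ δ)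
    (hpos : ∀ w : Fin n → ℝ,
      δ * (∑ k, |(smInvK Ainf Λup).mulVec (padK w) k|) ^ 2 ≤ dotProduct w ((redP Ainf Λup N).mulVec w)) :
    DualCert L g z₁ z₂ :=
  dualCert_of_pointCert L pts (Sum.elim (fun _ => (0 : ℝ)) N) _ hnbr
    (pointCert_of_real L pts _ (smInvK Ainf Λup)
      (pointReal_of_redSkeleton L g z₁ z₂ pts N hz Ainf hs hA Λup hΛ hcap δ hδ hpos))

end Reduced

end TwoHoleBS

end Summit.HubbardSuperconductivity.HubbardSuperconductivity.Theorems.AnisotropyChord.Transfer.Fibre3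

end
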